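import Literature.NumberTheory.Sieve.HardyLittlewoodTwinSieveProofs
import Literature.NumberTheory.Sieve.ChenShiftSeq
import HarnessLib

/-!
# The sieve upper bound for prime pairs `p, p + h` with constant `4`, uniformly in the shift

Topic `Literature/NumberTheory/Sieve`; companion of `HardyLittlewoodTwinSieveProofs.lean` (the case
`h = 2`: `TwinSieveFour.twinSieveUpperBound_four`, `π₂(x) ≤ (4 + o(1)) · 2C₂ x/log² x`). Everything
here is PROVED from results proved in the tree; no named fact is introduced or assumed.

**Main result** (`PrimePairSieve.primePairs_card_le_four`): for every `ε > 0`, for all large `x`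
and EVERY even `h ≠ 0`,

  `#{p ≤ x : p, p + h prime} ≤ (4 + ε) · 2 C₂ ∏_{p ∣ h, p > 2} (p-1)/(p-2) · x/(log x)²`,

i.e. `≤ (4 + ε) 𝔖(h) x/log² x` with the Hardy–Littlewood constant `𝔖(h) = 2 · Chen.singularSeries h`
(`Chen.singularSeries h = C₂ ∏_{p ∣ h, p>2} (p-1)/(p-2)`, `C₂ = Literature.twinPrimeConst`). This is
the classical Bombieri–Davenport / Halberstam–Richert bound (HR Thm 3.11; Montgomery–Vaughan,
*Multiplicative Number Theory I*, Cor. 3.14: `≤ 8 c(r) y/log² y (1 + O(log log y/log y))` "uniformly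
in `r`"), in the qualitative `(4 + ε)`-form with a threshold `x₀(ε)` INDEPENDENT of `h`.

Motivation: it is the input "Lemma 3" of Pintz–Ruzsa, *On Linnik's approximation to Goldbach's
problem, I*, Acta Arith. 109 (2003) (`R(h) < C · 2C₀ f(h) N/log² N` uniformly in even `h`, there with
Chen's constant `C = 3.9171`; here `C = 4 + ε`), needed uniformly for `h = 2^{m₂} - 2^{m₁} ≤ N` in
their Lemmas 10–11 on the way to the Goldbach–Linnik theorem
(`Literature.NumberTheory.Sieve.goldbach_linnik`, parity.S36); and it sharpens the tree's
unspecified-constant `Literature.NumberTheory.Sieve.primePairs_card_le` (same left-hand side).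

## The proof (= `TwinSieveFour`, with `𝒜_h(x) = {p + h : p ≤ x}` for `{p + 2 : 2 < p ≤ x}`)

1. `card_primePairs_le_roughCount_add`: `#{p ≤ x : p + h prime} ≤ S(𝒜_h(x), Z) + Z`.
2. `pairSeq h x`: the sifted sequence `1_{𝒜_h(x)}` with density `shiftedPrimesDensity h` and size
   `π(x)` — the tree's `Chen.chenShiftSeq` WITHOUT discarding the primes `p ≤ h`, so that
   (`abs_remainder_pairSeq_le`) `|r(d)| ≤ |π(x; d, −h) − π(x)/φ(d)| + 1` for every `d` (no `h + 1`
   term): `sifted_pairSeq`, `densityProduct_pairSeq` (`= Chen.sieveProduct h z`),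
   `hasIwaniecDimension_pairSeq` (dimension `Ω(1, L₀)` with `L₀ = Chen.dimConst` for ALL even `h`),
   `remainderSum_pairSeq_le` (into the Bombieri–Vinogradov sum with the residues `−h (mod d)`).
3. `sieveProduct_le_mul`: `V_h(z) ≤ V_2(z) · 𝔖(h)/C₂` (`Chen.sieveProduct_eq_mul`; local factors `≥ 1`).
4. `eventually_card_primePairs_le`: Iwaniec's Theorem 1 (`Iwaniec1980_thm1_upper_of_half_lt`,
   uniform in the sequence), `z = x^{1/4}`, `y = x^{1/2-δ}`, `F(s) = 2e^γ/s`; Bombieri–Vinogradov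
   (`Chen.eventually_sum_abs_primeCountingDisc_le`, which is uniform over residue selections, hence
   over `h`); one `h`-free majorant `M(x)` with `M(x) log² x/x → 8C₂/(1-2δ)` (PNT
   `tendsto_primeCounting_mul_log_div`, Mertens `TwinSieveFour.tendsto_sieveProduct_two_mul_log`)
   bounds `#pairs ≤ M(x) 𝔖(h)/C₂` for all `h` at once; `δ = min(1/8, ε/32)` gives the constant `4 + ε`.

## References

* E. Bombieri, H. Davenport, *Small differences between prime numbers*, Proc. Roy. Soc. A 293
  (1966) 1–18. [BombieriDavenport1966]
* H. Halberstam, H.-E. Richert, *Sieve Methods*, Academic Press 1974, Thm 3.11. [HalberstamRichert1974]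
* H. L. Montgomery, R. C. Vaughan, *Multiplicative Number Theory I*, CUP 2007, Cor. 3.14.
  [MontgomeryVaughan2007]
* H. Iwaniec, *Rosser's sieve*, Acta Arith. 36 (1980) 171–202, Thm 1. [IwaniecActaArith1980]
* J. Pintz, I. Z. Ruzsa, *On Linnik's approximation to Goldbach's problem, I*, Acta Arith. 109
  (2003) 169–194, §2 Lemma 3 and §8. [PintzRuzsa2003]
* M. B. Nathanson, *Additive Number Theory: The Classical Bases*, GTM 164 (1996), §10.3–10.4
  (the `π`-normalised shifted sequence). [Nathanson1996]
-/

open Finset Filter Topology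

noncomputable section

namespace Literature.NumberTheory.Sieve

namespace PrimePairSieve

open Chen ChenSieve SieveSequence

/-! ### Step 1: prime pairs are rough elements of `𝒜_h(x) = {p + h : p ≤ x}` -/

/-- For every `Z`: `#{p ≤ x : p, p + h prime} ≤ #{n ∈ 𝒜_h(x) : n has no prime factor < Z} + Z`
(`𝒜_h(x) = Chen.shiftSieveSet h x`): a prime `p + h ≥ Z` is `Z`-rough, and `p + h < Z` forces `p < Z`.
[folklore] -/
theorem card_primePairs_le_roughCount_add (x h Z : ℕ) :
    ((Nat.primesLE x).filter fun p => (p + h).Prime).card ≤ roughCount (shiftSieveSet h x) Z + Z := by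
  classical
  set S := (Nat.primesLE x).filter fun p => (p + h).Prime with hS
  rw [← Finset.card_filter_add_card_filter_not (s := S) (fun p => Z ≤ p + h)]
  refine Nat.add_le_add ?_ ?_
  · rw [roughCount]
    refine Finset.card_le_card_of_injOn (fun p => p + h) (fun p hp => ?_) (fun p _ q _ hpq => by
      simpa using hpq)
    rw [Finset.coe_filter, Set.mem_setOf_eq, hS, Finset.mem_filter, Nat.mem_primesLE] at hp
    obtain ⟨⟨⟨hpx, hp⟩, hph⟩, hZ⟩ := hp
    rw [Finset.coe_filter, Set.mem_setOf_eq]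
    refine ⟨mem_shiftSieveSet.mpr ⟨p, hp, hpx, rfl⟩, fun q hq => ?_⟩
    rw [Nat.Prime.primeFactors hph, Finset.mem_singleton] at hq
    rw [hq]
    exact hZ
  · calc ((S.filter fun p => ¬Z ≤ p + h).card) ≤ (range Z).card := by
          refine Finset.card_le_card fun p hp => ?_
          rw [Finset.mem_filter] at hp
          rw [Finset.mem_range]
          omega
      _ = Z := Finset.card_range Z

/-- Real form of Step 1 with `Z = ⌈z⌉`. [folklore] -/
theorem card_primePairs_le_roughCount_add_real (x h : ℕ) {z : ℝ} (hz : 0 ≤ z) :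
    (((Nat.primesLE x).filter fun p => (p + h).Prime).card : ℝ) ≤
      roughCount (shiftSieveSet h x) ⌈z⌉₊ + (z + 1) := by
  have h1 := card_primePairs_le_roughCount_add x h ⌈z⌉₊
  have h' : (((Nat.primesLE x).filter fun p => (p + h).Prime).card : ℝ) ≤
      (roughCount (shiftSieveSet h x) ⌈z⌉₊ : ℝ) + (⌈z⌉₊ : ℝ) := by exact_mod_cast h1
  exact h'.trans (by linarith [(Nat.ceil_lt_add_one hz).le])

/-! ### Step 2: the sifted sequence `𝒜_h(x)` (all `p ≤ x`, no coprimality restriction) -/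

/-- The weights `a(n) = 1_{𝒜_h(x)}(n)`, `𝒜_h(x) = {p + h : p ≤ x prime}`. [folklore] -/
def pairWeight (h x n : ℕ) : ℝ :=
  if n ∈ shiftSieveSet h x then 1 else 0

/-- `0 ≤ a(n)`. [folklore] -/
theorem pairWeight_nonneg (h x n : ℕ) : 0 ≤ pairWeight h x n := by
  unfold pairWeight; split_ifs <;> norm_num

/-- **The prime-pair sifted sequence** `𝒜_h(x) = {p + h : p ≤ x}`: weights `1_{𝒜}`, density
`g = shiftedPrimesDensity h` (`g(d) = 1/φ(d)` for `(d, h) = 1`, `0` otherwise), size `X = π(x)` —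
Halberstam–Richert's set-up for prime pairs (Ch. 3), in the `π`-normalisation of the tree's
`Chen.chenShiftSeq` but WITHOUT discarding the primes `p ≤ h` (so that the remainders stay uniform
in `h`). [cite: Nathanson1996, §10.3–10.4] -/
def pairSeq (h x : ℕ) : SieveSequence where
  a := pairWeight h x
  a_nonneg := pairWeight_nonneg h x
  size := fun _ => (Nat.primeCounting x : ℝ)
  density := shiftedPrimesDensity h
  density_mult := isMultiplicative_shiftedPrimesDensity h

/-- `∑_{n ∈ s} a(n) = #(s ∩ 𝒜_h(x))`. [folklore] -/
theorem sum_pairWeight (h x : ℕ) (s : Finset ℕ) :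
    ∑ n ∈ s, pairWeight h x n = ((s.filter fun n => n ∈ shiftSieveSet h x).card : ℝ) := by
  classical
  rw [Finset.card_filter, Nat.cast_sum]
  refine Finset.sum_congr rfl fun n _ => ?_
  unfold pairWeight
  split_ifs <;> simp

/-- **`S(𝒜, P(z); x + h) = S(𝒜_h(x), ⌈z⌉)`**. [cite: Nathanson1996, (10.6)] -/
theorem sifted_pairSeq (h x : ℕ) (z : ℝ) :
    (pairSeq h x).sifted ((x + h : ℕ) : ℝ) (primesProdBelow z) = roughCount (shiftSieveSet h x) ⌈z⌉₊ := by
  classical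
  change ∑ n ∈ (Finset.Ioc 0 ⌊((x + h : ℕ) : ℝ)⌋₊).filter (fun n : ℕ => n.Coprime (primesProdBelow z)),
    pairWeight h x n = _
  rw [sum_pairWeight, roughCount, Finset.filter_filter, Nat.floor_natCast]
  congr 2
  ext n
  rw [Finset.mem_filter, Finset.mem_filter]
  constructor
  · rintro ⟨hn0, hcop, hn⟩
    have hn0' : n ≠ 0 := by have := (Finset.mem_Ioc.mp hn0).1; omega
    exact ⟨hn, (coprime_primesProdBelow_iff_isRough hn0').mp hcop⟩
  · rintro ⟨hn, hr⟩
    have hnI := shiftSieveSet_subset_Ioc h x hn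
    have hn0' : n ≠ 0 := by have := (Finset.mem_Ioc.mp hnI).1; omega
    exact ⟨hnI, (coprime_primesProdBelow_iff_isRough hn0').mpr hr, hn⟩

/-- **`V(P(z)) = V_h(z) = Chen.sieveProduct h z`** (the density is that of `Chen.chenShiftSeq h x`).
[cite: Nathanson1996, (10.8)] -/
theorem densityProduct_pairSeq (h x : ℕ) (z : ℝ) :
    (pairSeq h x).densityProduct (primesProdBelow z) = sieveProduct h z := by
  have : (pairSeq h x).densityProduct (primesProdBelow z) =
      (chenShiftSeq h x).densityProduct (primesProdBelow z) := rfl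
  rw [this, densityProduct_chenShiftSeq]

/-- The size is `π(x)` at every height. [folklore] -/
theorem size_pairSeq (h x : ℕ) (t : ℝ) : (pairSeq h x).size t = Nat.primeCounting x := rfl

/-- **Dimension `Ω(1, L₀)`** for even `h`, with the absolute constant `L₀ = Chen.dimConst`, the SAME
for every `h` (the density is that of `chenGoldbachSeq h`). [cite: Nathanson1996, §10.3 (9.33)–(9.34)] -/
theorem hasIwaniecDimension_pairSeq {h : ℕ} (hh : Even h) (x : ℕ) :
    HasIwaniecDimension (pairSeq h x).density 1 dimConst :=
  hasIwaniecDimension_chenGoldbachSeq (N := h) hh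

/-- `|𝒜_d| = #{p ≤ x prime : d ∣ p + h}`. [cite: Nathanson1996, (10.9)] -/
theorem congrSum_pairSeq (h x d : ℕ) :
    (pairSeq h x).congrSum d ((x + h : ℕ) : ℝ) =
      (((range (x + 1)).filter fun p => p.Prime ∧ d ∣ p + h).card : ℝ) := by
  classical
  change ∑ n ∈ (Finset.Ioc 0 ⌊((x + h : ℕ) : ℝ)⌋₊).filter (d ∣ ·), pairWeight h x n = _
  rw [sum_pairWeight, Finset.filter_filter, Nat.floor_natCast]
  have h1 : (Finset.Ioc 0 (x + h)).filter (fun n => d ∣ n ∧ n ∈ shiftSieveSet h x) =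
      ((range (x + 1)).filter fun p => p.Prime ∧ d ∣ p + h).map (addRightEmbedding h) := by
    ext n
    rw [Finset.mem_filter, Finset.mem_map]
    constructor
    · rintro ⟨-, hdn, hn⟩
      obtain ⟨p, hp, hpx, rfl⟩ := mem_shiftSieveSet.mp hn
      exact ⟨p, Finset.mem_filter.mpr ⟨Finset.mem_range.mpr (by omega), hp, hdn⟩, rfl⟩
    · rintro ⟨p, hp, rfl⟩
      rw [Finset.mem_filter, Finset.mem_range] at hp
      obtain ⟨hpx, hp, hdvd⟩ := hp
      have hmem : p + h ∈ shiftSieveSet h x := mem_shiftSieveSet.mpr ⟨p, hp, by omega, rfl⟩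
      exact ⟨shiftSieveSet_subset_Ioc h x hmem, hdvd, hmem⟩
  rw [h1, Finset.card_map]

/-- **The remainder of the prime-pair sequence, uniformly in `h`**: for `d ≠ 0`,
`|r(d)| ≤ |π(x; d, −h) − π(x)/φ(d)| + 1` — for `(d, h) = 1`, `|𝒜_d| = π(x; d, −h)` exactly; for
`(d, h) > 1` the density vanishes and a common prime factor `q` of `d`, `h` divides `p + h` only for
`p = q`, so `|𝒜_d| ≤ 1`. (Compare `Chen.abs_remainder_chenShiftSeq_le`, whose error `h + 1` comes
from discarding `p ≤ h`.) [cite: Nathanson1996, §10.4 (proof of Thm 10.4)] -/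
theorem abs_remainder_pairSeq_le {h x d : ℕ} (hd : d ≠ 0) :
    |(pairSeq h x).remainder d ((x + h : ℕ) : ℝ)| ≤
      |primeCountingDisc d (negResUnit h d : ZMod d) x| + 1 := by
  classical
  rw [SieveSequence.remainder, congrSum_pairSeq]
  change |((((range (x + 1)).filter fun p => p.Prime ∧ d ∣ p + h).card : ℝ)) -
      shiftedPrimesDensity h d * (Nat.primeCounting x : ℝ)| ≤ _
  rw [shiftedPrimesDensity_apply]
  by_cases hcop : d.Coprime h
  · rw [if_pos ⟨hcop, hd⟩, primeCountingDisc_eq_card_sub, coe_negResUnit hcop.symm]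
    have hset : ((range (x + 1)).filter fun p => p.Prime ∧ d ∣ p + h) =
        (range (x + 1)).filter fun p => p.Prime ∧ ((p : ℕ) : ZMod d) = -(h : ZMod d) := by
      refine Finset.filter_congr fun p _ => ?_
      rw [natCast_eq_neg_iff_dvd]
    rw [hset, div_eq_mul_inv, mul_comm ((Nat.primeCounting x : ℝ))]
    linarith [abs_nonneg ((((range (x + 1)).filter fun p =>
      p.Prime ∧ ((p : ℕ) : ZMod d) = -(h : ZMod d)).card : ℝ) -
      ((Nat.totient d : ℝ))⁻¹ * (Nat.primeCounting x : ℝ))]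
  · -- `(d, h) > 1`
    have hne : Nat.gcd d h ≠ 1 := hcop
    obtain ⟨q, hq, hqg⟩ := Nat.exists_prime_and_dvd hne
    have hqd : q ∣ d := hqg.trans (Nat.gcd_dvd_left d h)
    have hqh : q ∣ h := hqg.trans (Nat.gcd_dvd_right d h)
    have hsub : ((range (x + 1)).filter fun p => p.Prime ∧ d ∣ p + h) ⊆ {q} := by
      intro p hp
      rw [Finset.mem_filter] at hp
      rw [Finset.mem_singleton]
      have hqp : q ∣ p := (Nat.dvd_add_left hqh).mp (hqd.trans hp.2.2)
      exact ((Nat.prime_dvd_prime_iff_eq hq hp.2.1).mp hqp).symm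
    have hcard : (((range (x + 1)).filter fun p => p.Prime ∧ d ∣ p + h).card : ℝ) ≤ 1 := by
      have := Finset.card_le_card hsub
      rw [Finset.card_singleton] at this
      exact_mod_cast this
    have hcard0 : (0 : ℝ) ≤ (((range (x + 1)).filter fun p => p.Prime ∧ d ∣ p + h).card : ℝ) :=
      Nat.cast_nonneg _
    rw [if_neg fun hc => hcop hc.1, zero_mul, sub_zero, abs_of_nonneg hcard0]
    linarith [abs_nonneg (primeCountingDisc d (negResUnit h d : ZMod d) x)]

/-- **The remainder sum is dominated by the Bombieri–Vinogradov sum, uniformly in `h`**: for `y ≥ 0`, `∑_{d < y, d ∣ P(z)} |r(d)| ≤ ∑_{d ≤ y} |π(x; d, −h) − π(x)/φ(d)| + y`.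
[cite: Nathanson1996, §10.4 (proof of Thm 10.4)] -/
theorem remainderSum_pairSeq_le (h x : ℕ) (z : ℝ) {y : ℝ} (hy : 0 ≤ y) :
    ∑ d ∈ (Finset.range ⌈y⌉₊).filter (· ∣ primesProdBelow z),
        |(pairSeq h x).remainder d ((x + h : ℕ) : ℝ)| ≤
      (∑ d ∈ Icc 1 ⌊y⌋₊, |primeCountingDisc d (negResUnit h d : ZMod d) x|) + y := by
  have hsub : (Finset.range ⌈y⌉₊).filter (· ∣ primesProdBelow z) ⊆ Icc 1 ⌊y⌋₊ := by
    intro d hd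
    rw [Finset.mem_filter, Finset.mem_range] at hd
    have hd0 : d ≠ 0 := fun h0 => primesProdBelow_ne_zero z (zero_dvd_iff.mp (h0 ▸ hd.2))
    rw [Finset.mem_Icc]
    exact ⟨Nat.pos_of_ne_zero hd0, Nat.le_floor (Nat.lt_ceil.mp hd.1).le⟩
  calc ∑ d ∈ (Finset.range ⌈y⌉₊).filter (· ∣ primesProdBelow z),
        |(pairSeq h x).remainder d ((x + h : ℕ) : ℝ)|
      ≤ ∑ d ∈ (Finset.range ⌈y⌉₊).filter (· ∣ primesProdBelow z),
          (|primeCountingDisc d (negResUnit h d : ZMod d) x| + 1) := by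
        refine Finset.sum_le_sum fun d hd => ?_
        rw [Finset.mem_filter] at hd
        have hd0 : d ≠ 0 := fun h0 => primesProdBelow_ne_zero z (zero_dvd_iff.mp (h0 ▸ hd.2))
        exact abs_remainder_pairSeq_le hd0
    _ ≤ ∑ d ∈ Icc 1 ⌊y⌋₊, (|primeCountingDisc d (negResUnit h d : ZMod d) x| + 1) :=
        Finset.sum_le_sum_of_subset_of_nonneg hsub fun d _ _ => by positivity
    _ = (∑ d ∈ Icc 1 ⌊y⌋₊, |primeCountingDisc d (negResUnit h d : ZMod d) x|) + ⌊y⌋₊ := by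
        rw [Finset.sum_add_distrib, Finset.sum_const, Nat.card_Icc, Nat.add_sub_cancel, nsmul_eq_mul,
          mul_one]
    _ ≤ _ := by gcongr; exact Nat.floor_le hy

/-! ### Step 3: `V_h(z) ≤ V_2(z) · 𝔖(h)/C₂` -/

/-- **Uniform comparison of the sieve products**: for even `h ≠ 0` and `z > 2`,
`V_h(z) ≤ V_2(z) · ∏_{p ∣ h, p > 2} (p-1)/(p-2) = V_2(z) · 𝔖(h)/C₂`
(`Chen.sieveProduct_eq_mul`: `V_N(z) = 2 U(z) T(z) ∏_{p ∣ N, 2 < p < z} (p-1)/(p-2)`, and each local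
factor is `≥ 1`; `Chen.singularSeries h = C₂ ∏_{p ∣ h, p>2} (p-1)/(p-2)`).
[cite: Nathanson1996, Thm 10.3 (proof)] -/
theorem sieveProduct_le_mul {h : ℕ} (hh : Even h) (hh0 : h ≠ 0) {z : ℝ} (hz : 2 < z) :
    sieveProduct h z ≤ sieveProduct 2 z * (Chen.singularSeries h / twinPrimeConst) := by
  have hC2 : 0 < twinPrimeConst := twinPrimeConst_pos_holds
  rw [sieveProduct_eq_mul hh hh0 hz, sieveProduct_eq_mul even_two two_ne_zero hz,
    Nat.Prime.primeFactors Nat.prime_two]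
  have hQ : ((({2} : Finset ℕ).filter (2 < ·)).filter (· < ⌈z⌉₊)) = ∅ := by
    rw [Finset.filter_singleton, if_neg (lt_irrefl 2), Finset.filter_empty]
  rw [hQ, Finset.prod_empty, mul_one]
  have hratio : Chen.singularSeries h / twinPrimeConst =
      ∏ p ∈ h.primeFactors.filter (2 < ·), (((p : ℝ) - 1) / ((p : ℝ) - 2)) := by
    rw [Chen.singularSeries]
    field_simp
  rw [hratio]
  -- the common factor `2 U(z) T(z) ≥ 0`
  have hU : 0 ≤ ∏ p ∈ Nat.primesBelow ⌈z⌉₊, (1 - (p : ℝ)⁻¹) :=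
    Finset.prod_nonneg fun p hp => by
      have hp2 : (2 : ℝ) ≤ p := by exact_mod_cast (Nat.prime_of_mem_primesBelow hp).two_le
      have : (p : ℝ)⁻¹ ≤ 1 / 2 := by rw [inv_eq_one_div]; exact one_div_le_one_div_of_le two_pos hp2
      linarith
  have hT : 0 ≤ ∏ p ∈ (Nat.primesBelow ⌈z⌉₊).filter (2 < ·), (1 - 1 / ((p : ℝ) - 1) ^ 2) :=
    Finset.prod_nonneg fun p hp => by
      have hp3 : 2 < p := (Finset.mem_filter.mp hp).2
      have hp3' : (3 : ℝ) ≤ p := by exact_mod_cast hp3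
      have h4 : (4 : ℝ) ≤ ((p : ℝ) - 1) ^ 2 := by nlinarith
      have : 1 / ((p : ℝ) - 1) ^ 2 ≤ 1 / 4 := one_div_le_one_div_of_le (by norm_num) h4
      linarith
  have hfac : ∀ p ∈ h.primeFactors.filter (2 < ·), (1 : ℝ) ≤ ((p : ℝ) - 1) / ((p : ℝ) - 2) := by
    intro p hp
    have hp3 : 2 < p := (Finset.mem_filter.mp hp).2
    have hp3' : (3 : ℝ) ≤ p := by exact_mod_cast hp3
    rw [le_div_iff₀ (by linarith)]
    linarith
  have hsub : (h.primeFactors.filter (2 < ·)).filter (· < ⌈z⌉₊) ⊆ h.primeFactors.filter (2 < ·) :=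
    Finset.filter_subset _ _
  have hprod : ∏ p ∈ (h.primeFactors.filter (2 < ·)).filter (· < ⌈z⌉₊), (((p : ℝ) - 1) / ((p : ℝ) - 2)) ≤
      ∏ p ∈ h.primeFactors.filter (2 < ·), (((p : ℝ) - 1) / ((p : ℝ) - 2)) :=
    Finset.prod_le_prod_of_subset_of_one_le hsub
      (fun p hp => zero_le_one.trans (hfac p (hsub hp))) fun p hp _ => hfac p hp
  have h2UT : 0 ≤ 2 * (∏ p ∈ Nat.primesBelow ⌈z⌉₊, (1 - (p : ℝ)⁻¹)) *
      ∏ p ∈ (Nat.primesBelow ⌈z⌉₊).filter (2 < ·), (1 - 1 / ((p : ℝ) - 1) ^ 2) := by positivity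
  exact mul_le_mul_of_nonneg_left hprod h2UT

/-! ### Step 4: the linear sieve at level `x^{1/2-δ}`, uniformly in `h` -/

set_option maxHeartbeats 400000 in
/-- **The linear sieve upper bound for prime pairs at level `x^{1/2-δ}`, uniformly in the shift.**
For `0 < δ ≤ 1/8` and `η > 0`, for all large `x` and EVERY even `h ≠ 0`:
`#{p ≤ x : p, p + h prime} ≤ (8/(1 - 2δ) + η) · 𝔖(h)/2 … ` precisely
`≤ (8/(1 - 2δ) + η) · Chen.singularSeries h · x/(log x)²`, `Chen.singularSeries h = C₂ ∏_{p ∣ h, p>2} (p-1)/(p-2)`.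
Proof = `TwinSieveFour.eventually_twinPrimeCount_le` with `𝒜_h(x)` for `𝒜(x)`: Iwaniec's Theorem 1
(upper bound, `κ = 1`, uniform in the sequence) for `pairSeq h x` (dimension `Ω(1, L₀)` with the SAME
`L₀` for all `h`), `z = x^{1/4}`, `y = x^{1/2-δ}`; the remainder by Bombieri–Vinogradov in the
`π`-form with the maximum over residues (`Chen.eventually_sum_abs_primeCountingDisc_le`, uniform in
`h`, plus `y` from `remainderSum_pairSeq_le`); the main term through `V_h(z) ≤ V_2(z) 𝔖(h)/C₂`
(`sieveProduct_le_mul`) and `𝔖(h)/C₂ ≥ 1`, so that ONE majorant `M(x) 𝔖(h)/C₂` with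
`M(x) (log x)²/x → 8C₂/(1-2δ)` (PNT and Mertens as in the twin case) serves every `h`. This is
Halberstam–Richert's Theorem 3.11-type bound `≤ 8 ∏_{p>2}(1-(p-1)^{-2}) ∏_{2<p∣h}(p-1)/(p-2) · x/log²x (1+o(1))`
uniformly in `h` (Montgomery–Vaughan, *Multiplicative Number Theory I*, Cor. 3.14: "uniformly in `r`").
[cite: MontgomeryVaughan2007, Corollary 3.14] [cite: IwaniecActaArith1980, Thm 1 (1.4)] -/
theorem eventually_card_primePairs_le {δ η : ℝ} (hδ : 0 < δ) (hδ1 : δ ≤ 1 / 8) (hη : 0 < η) :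
    ∀ᶠ x : ℕ in atTop, ∀ h : ℕ, Even h → h ≠ 0 →
      (((Nat.primesLE x).filter fun p => (p + h).Prime).card : ℝ) ≤
        (8 / (1 - 2 * δ) + η) * Chen.singularSeries h * x / Real.log x ^ 2 := by
  set G := Real.exp Real.eulerMascheroniConstant with hG
  have hG0 : 0 < G := Real.exp_pos _
  set θ₁ := 1 / 2 - δ with hθ₁
  have hθ₁lt : θ₁ < 1 / 2 := by rw [hθ₁]; linarith
  have hθ₁0 : 0 < θ₁ := by rw [hθ₁]; linarith
  have hθ₁ge : 1 / 4 ≤ θ₁ := by rw [hθ₁]; linarith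
  have h12δ : 0 < 1 - 2 * δ := by linarith
  set s := 4 * θ₁ with hs
  have hs0 : 0 < s := by positivity
  have hs3 : s ≤ 3 := by rw [hs, hθ₁]; linarith
  have hseq : s = 2 * (1 - 2 * δ) := by rw [hs, hθ₁]; ring
  have hC2 : 0 < twinPrimeConst := twinPrimeConst_pos_holds
  -- Iwaniec's Theorem 1 (upper bound) for `κ = 1`, with `F(s) = 2e^γ/s` on `(0, 3]`
  obtain ⟨B, hB, hBC⟩ := Iwaniec1980_thm1_upper_of_half_lt (κ := 1) (by norm_num)
  obtain ⟨CI, hCI⟩ := hBC dimConst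
  have hFeq : Set.EqOn B.1 (iwaniecUpperSieveFun 1) (Set.Ioi 0) := hB.eqOn_iwaniecSieveFun.1
  have hFs : B.1 s = 2 * G / s := by
    rw [hFeq hs0, ← upperSieveFun_one, upperSieveFun_one_eq_holds ⟨hs0, hs3⟩]
  -- Bombieri–Vinogradov in `π`-form at level `x^{θ₁}`, uniformly over residues
  obtain ⟨C, hC⟩ := eventually_sum_abs_primeCountingDisc_le BombieriVinogradovStatement_holds hθ₁lt
    (A := 4) (by norm_num)
  -- the explicit majorant `M` (independent of `h`)
  set E : ℕ → ℝ := fun x => |CI| * (θ₁ * Real.log (x : ℝ)) ^ (-(1 / 3 : ℝ)) with hE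
  have hE0 : ∀ x : ℕ, 0 ≤ E x := fun x =>
    mul_nonneg (abs_nonneg _) (Real.rpow_nonneg (mul_nonneg hθ₁0.le (Real.log_natCast_nonneg x)) _)
  set M : ℕ → ℝ := fun x =>
    (Nat.primeCounting x : ℝ) * sieveProduct 2 ((x : ℝ) ^ (1 / 4 : ℝ)) * (2 * G / s + E x) +
      (C * x / Real.log x ^ 4 + (x : ℝ) ^ θ₁) + ((x : ℝ) ^ (1 / 4 : ℝ) + 1) with hM
  -- (a) eventually, for every even `h ≠ 0`: `pairs(x, h) ≤ M(x) · 𝔖(h)/C₂`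
  have hle : ∀ᶠ x : ℕ in atTop, ∀ h : ℕ, Even h → h ≠ 0 →
      (((Nat.primesLE x).filter fun p => (p + h).Prime).card : ℝ) ≤
        M x * (Chen.singularSeries h / twinPrimeConst) := by
    filter_upwards [eventually_ge_atTop 81, hC] with x hx hBVx h hh hh0
    have hx2 : 2 ≤ x := by omega
    have hx1 : (1 : ℝ) < x := by exact_mod_cast (show 1 < x by omega)
    have hx0 : (0 : ℝ) < x := by linarith
    set z := (x : ℝ) ^ (1 / 4 : ℝ) with hz
    set y := (x : ℝ) ^ θ₁ with hy
    have hz3 : 3 ≤ z := by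
      rw [hz, show (3 : ℝ) = ((3 : ℝ) ^ (4 : ℕ)) ^ (1 / 4 : ℝ) by
        rw [← Real.rpow_natCast, ← Real.rpow_mul (by norm_num)]; norm_num]
      exact Real.rpow_le_rpow (by norm_num) (by exact_mod_cast (show 81 ≤ x from hx)) (by norm_num)
    have hz2 : 2 < z := by linarith
    have hz2le : 2 ≤ z := by linarith
    have hz0 : 0 ≤ z := by linarith
    have hzy : z ≤ y := by
      rw [hz, hy]
      exact Real.rpow_le_rpow_of_exponent_le hx1.le hθ₁ge
    have hy0 : 0 ≤ y := Real.rpow_nonneg hx0.le _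
    have hlogz : Real.log z = 1 / 4 * Real.log x := by rw [hz, Real.log_rpow hx0]
    have hlogy : Real.log y = θ₁ * Real.log x := by rw [hy, Real.log_rpow hx0]
    have hlog : 0 < Real.log x := Real.log_pos hx1
    have hsxy : Real.log y / Real.log z = s := by
      rw [hlogz, hlogy, hs]
      field_simp
    set P := (Nat.primeCounting x : ℝ) with hP
    have hP0 : 0 ≤ P := Nat.cast_nonneg _
    have hsz : (pairSeq h x).size ((x + h : ℕ) : ℝ) = P := rfl
    -- Iwaniec's theorem for the pair sequence at height `x + h`
    have hI := hCI (pairSeq h x) (hasIwaniecDimension_pairSeq hh x) ((x + h : ℕ) : ℝ) y z hz2le hzy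
      (by rw [hsz]; exact hP0)
    rw [hsz, densityProduct_pairSeq, sifted_pairSeq, hsxy, hFs] at hI
    -- the remainder, by Bombieri–Vinogradov (uniform in `h`)
    have hBVh := hBVx (fun d => negResUnit h d)
    rw [show (4 : ℝ) = ((4 : ℕ) : ℝ) by norm_num, Real.rpow_natCast] at hBVh
    have hRle : ∑ d ∈ (Finset.range ⌈y⌉₊).filter (· ∣ primesProdBelow z),
        |(pairSeq h x).remainder d ((x + h : ℕ) : ℝ)| ≤ C * x / Real.log x ^ 4 + y :=
      (remainderSum_pairSeq_le h x z hy0).trans (add_le_add hBVh le_rfl)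
    have hCx0 : 0 ≤ C * x / Real.log x ^ 4 :=
      (Finset.sum_nonneg fun d _ => abs_nonneg _).trans hBVh
    -- the main term
    set K := Chen.singularSeries h / twinPrimeConst with hK
    have hK1 : 1 ≤ K := by
      rw [hK, le_div_iff₀ hC2, one_mul]
      exact twinPrimeConst_le_singularSeries h
    have hVh0 : 0 ≤ sieveProduct h z := (sieveProduct_mem_Icc hh z).1
    have hV20 : 0 ≤ sieveProduct 2 z := (sieveProduct_mem_Icc even_two z).1
    have hV : sieveProduct h z ≤ sieveProduct 2 z * K := sieveProduct_le_mul hh hh0 hz2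
    have hF0 : 0 ≤ 2 * G / s + E x := add_nonneg (by positivity) (hE0 x)
    have hEx : CI * Real.log y ^ (-(1 / 3 : ℝ)) ≤ E x := by
      simp only [hE, hlogy]
      exact mul_le_mul_of_nonneg_right (le_abs_self CI) (Real.rpow_nonneg (by positivity) _)
    -- assemble
    calc (((Nat.primesLE x).filter fun p => (p + h).Prime).card : ℝ)
        ≤ roughCount (shiftSieveSet h x) ⌈z⌉₊ + (z + 1) := card_primePairs_le_roughCount_add_real x h hz0
      _ ≤ P * sieveProduct h z * (2 * G / s + CI * Real.log y ^ (-(1 / 3 : ℝ))) +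
            ∑ d ∈ (Finset.range ⌈y⌉₊).filter (· ∣ primesProdBelow z),
              |(pairSeq h x).remainder d ((x + h : ℕ) : ℝ)| + (z + 1) := by linarith
      _ ≤ P * sieveProduct h z * (2 * G / s + E x) + (C * x / Real.log x ^ 4 + y) + (z + 1) := by
          have h1 : P * sieveProduct h z * (2 * G / s + CI * Real.log y ^ (-(1 / 3 : ℝ))) ≤
              P * sieveProduct h z * (2 * G / s + E x) :=
            mul_le_mul_of_nonneg_left (by linarith) (mul_nonneg hP0 hVh0)
          linarith
      _ ≤ P * (sieveProduct 2 z * K) * (2 * G / s + E x) + (C * x / Real.log x ^ 4 + y) + (z + 1) := by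
          have h1 : P * sieveProduct h z ≤ P * (sieveProduct 2 z * K) := mul_le_mul_of_nonneg_left hV hP0
          have h2 := mul_le_mul_of_nonneg_right h1 hF0
          linarith
      _ ≤ (P * sieveProduct 2 z * (2 * G / s + E x) + (C * x / Real.log x ^ 4 + y) + (z + 1)) * K := by
          have hR0 : 0 ≤ (C * x / Real.log x ^ 4 + y) + (z + 1) := by positivity
          have hmain0 : 0 ≤ P * sieveProduct 2 z * (2 * G / s + E x) := by positivity
          nlinarith
      _ = M x * K := by simp only [hM, hP, hz, hy]
  -- (b) `M(x) (log x)²/x → 8 C₂/(1 - 2δ)`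
  have hlim : Tendsto (fun x : ℕ => M x * (Real.log x ^ 2 / x)) atTop
      (𝓝 (8 * twinPrimeConst / (1 - 2 * δ))) := by
    have hT1 := Literature.NumberTheory.Sieve.tendsto_primeCounting_mul_log_div
    have hT2 := TwinSieveFour.tendsto_sieveProduct_two_mul_log
    have hT3 : Tendsto E atTop (𝓝 0) := by
      have h := ((tendsto_rpow_neg_atTop (by norm_num : (0 : ℝ) < 1 / 3)).comp
        ((Real.tendsto_log_atTop.comp tendsto_natCast_atTop_atTop).const_mul_atTop hθ₁0)).const_mul |CI|
      rw [mul_zero] at h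
      refine h.congr fun x => ?_
      simp only [hE, Function.comp_apply]
    have hT4a : Tendsto (fun x : ℕ => C / Real.log (x : ℝ) ^ 2) atTop (𝓝 0) :=
      tendsto_const_nhds.div_atTop ((tendsto_pow_atTop two_ne_zero).comp
        (Real.tendsto_log_atTop.comp tendsto_natCast_atTop_atTop))
    have hT4b := TwinSieveFour.tendsto_log_sq_div_rpow (1 - θ₁) (by linarith)
    have hT4c := TwinSieveFour.tendsto_log_sq_div_rpow (3 / 4) (by norm_num)
    have hT4d := TwinSieveFour.tendsto_log_sq_div_rpow 1 one_pos
    have hsum := (((hT1.mul hT2).mul ((tendsto_const_nhds (x := 2 * G / s)).add hT3)).add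
      (hT4a.add hT4b)).add (hT4c.add hT4d)
    have hval : 1 * (8 * twinPrimeConst * Real.exp (-Real.eulerMascheroniConstant)) * (2 * G / s + 0) +
        (0 + 0) + (0 + 0) = 8 * twinPrimeConst / (1 - 2 * δ) := by
      rw [hseq, hG, Real.exp_neg, add_zero, add_zero, add_zero, add_zero, one_mul]
      field_simp
    rw [hval] at hsum
    refine hsum.congr' ?_
    filter_upwards [eventually_gt_atTop 1] with x hx
    have hx1 : (1 : ℝ) < x := by exact_mod_cast hx
    have hx0 : (0 : ℝ) < x := by linarith
    have hlog : 0 < Real.log x := Real.log_pos hx1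
    have hxq : (0 : ℝ) < (x : ℝ) ^ (1 / 4 : ℝ) := Real.rpow_pos_of_pos hx0 _
    have hxt : (0 : ℝ) < (x : ℝ) ^ θ₁ := Real.rpow_pos_of_pos hx0 _
    have e1 : (x : ℝ) ^ (1 - θ₁) = x / (x : ℝ) ^ θ₁ := by
      rw [Real.rpow_sub hx0, Real.rpow_one]
    have e2 : (x : ℝ) ^ (3 / 4 : ℝ) = x / (x : ℝ) ^ (1 / 4 : ℝ) := by
      rw [show (3 / 4 : ℝ) = 1 - 1 / 4 by norm_num, Real.rpow_sub hx0, Real.rpow_one]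
    simp only [hM]
    rw [e1, e2, Real.rpow_one]
    field_simp
  -- (c) conclusion
  have hlt : 8 * twinPrimeConst / (1 - 2 * δ) < (8 / (1 - 2 * δ) + η) * twinPrimeConst := by
    rw [add_mul, div_mul_eq_mul_div]
    linarith [mul_pos hη hC2]
  filter_upwards [hle, hlim.eventually (gt_mem_nhds hlt), eventually_gt_atTop 1] with x hxle hxlt hx h hh hh0
  have hx1 : (1 : ℝ) < x := by exact_mod_cast hx
  have hx0 : (0 : ℝ) < x := by linarith
  have hlog : 0 < Real.log x := Real.log_pos hx1
  have hpos : 0 < Real.log x ^ 2 / x := by positivity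
  have hM' : M x < (8 / (1 - 2 * δ) + η) * twinPrimeConst * x / Real.log x ^ 2 := by
    rw [← div_div_eq_mul_div]
    exact (lt_div_iff₀ hpos).mpr hxlt
  have hK0 : 0 ≤ Chen.singularSeries h / twinPrimeConst := by
    have := singularSeries_pos h; positivity
  calc (((Nat.primesLE x).filter fun p => (p + h).Prime).card : ℝ)
      ≤ M x * (Chen.singularSeries h / twinPrimeConst) := hxle h hh hh0
    _ ≤ ((8 / (1 - 2 * δ) + η) * twinPrimeConst * x / Real.log x ^ 2) *
          (Chen.singularSeries h / twinPrimeConst) := mul_le_mul_of_nonneg_right hM'.le hK0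
    _ = (8 / (1 - 2 * δ) + η) * Chen.singularSeries h * x / Real.log x ^ 2 := by
        field_simp

/-- **The sieve upper bound for prime pairs with constant `4`, uniformly in the shift**
(Bombieri–Davenport 1966; Halberstam–Richert, *Sieve Methods*, Thm 3.11; Montgomery–Vaughan,
*Multiplicative Number Theory I*, Cor. 3.14, "uniformly in `r`"): for every `ε > 0`, for all large `x`
and EVERY even `h ≠ 0`,
`#{p ≤ x : p, p + h prime} ≤ (4 + ε) · 2 C₂ ∏_{p ∣ h, p > 2} (p-1)/(p-2) · x/(log x)²`
(`= (4 + ε) 𝔖(h) x/log² x` with the Hardy–Littlewood constant `𝔖(h) = 2 · Chen.singularSeries h`; the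
case `h = 2` is the tree's `TwinSieveFour.twinSieveUpperBound_four`). In Pintz–Ruzsa's notation
(Acta Arith. 109 (2003), Lemma 3 with Chen's `C = 3.9171`) this is `R(h) < C · 2C₀ f(h) N/log² N`
with `C = 4 + ε`. [cite: MontgomeryVaughan2007, Corollary 3.14] [cite: BombieriDavenport1966]
[cite: PintzRuzsa2003, §2 Lemma 3 (with C = 4 + ε in place of 3.9171)] -/
theorem primePairs_card_le_four (ε : ℝ) (hε : 0 < ε) :
    ∀ᶠ x : ℕ in atTop, ∀ h : ℕ, Even h → h ≠ 0 →
      (((Nat.primesLE x).filter fun p => (p + h).Prime).card : ℝ) ≤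
        (4 + ε) * 2 * Chen.singularSeries h * x / Real.log x ^ 2 := by
  set δ := min (1 / 8) (ε / 32) with hδ
  have hδ0 : 0 < δ := by positivity
  have hδ1 : δ ≤ 1 / 8 := min_le_left _ _
  have hδ2 : δ ≤ ε / 32 := min_le_right _ _
  have hfrac : 8 / (1 - 2 * δ) ≤ 8 + ε := by
    rw [div_le_iff₀ (by linarith)]
    have h1 : 2 * ε * δ ≤ 2 * ε * (1 / 8) := mul_le_mul_of_nonneg_left hδ1 (by positivity)
    nlinarith
  filter_upwards [eventually_card_primePairs_le hδ0 hδ1 hε, eventually_gt_atTop 1] with x hx hx1 h hh hh0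
  refine (hx h hh hh0).trans ?_
  have hx1' : (1 : ℝ) < x := by exact_mod_cast hx1
  have hlog : 0 < Real.log x := Real.log_pos hx1'
  have hS : 0 < Chen.singularSeries h := singularSeries_pos h
  have h0 : (0 : ℝ) ≤ Chen.singularSeries h * x / Real.log x ^ 2 := by positivity
  calc (8 / (1 - 2 * δ) + ε) * Chen.singularSeries h * x / Real.log x ^ 2
      = (8 / (1 - 2 * δ) + ε) * (Chen.singularSeries h * x / Real.log x ^ 2) := by ring
    _ ≤ (8 + ε + ε) * (Chen.singularSeries h * x / Real.log x ^ 2) := by gcongr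
    _ = (4 + ε) * 2 * Chen.singularSeries h * x / Real.log x ^ 2 := by ring

end PrimePairSieve

end Literature.NumberTheory.Sieve

end
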